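import Summits.QuantumFields.YangMills.Theorems.BalabanUVNodesN15KingModelSrcDivMismatch
import HarnessLib

/-!
# BalabanUVNodes ∕ N15 — THE KING-MODEL RUNG, PROGRAMME Y (the dressed SOURCE-DIVERGENCE entry of the King jet), FILE 70d:
# THE STEP ROWS OF THE BY-PARTS DEVICE — the transported letter mismatch `P∘(𝕄̄ − 𝕄̄₁)∘Ȳ` at King's two-grid letters (Σ_μ TERM A + TERM B of FILE 70c), the fine
# by-parts step `𝕄′ = G′M_{w′} + Σ_μ (G′N′∇′_μ)M_{ã′_μ}` and its η-defect against the FITTED coarse step `𝕄̄₁` — all behind ABSTRACT fronts with rows as hypotheses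

WHO ∕ WHEN.  Cell `pub-ymgap`, seat `pub-ymgap-dag-n15-d` (R134, N15 NE2 s3 = King-model rung, g22); `--kind proof --supports stmt-QuantumFields-27366 --as helper`
(K3⁸; count-neutral).  THEOREMS ONLY (0 `def`).  Over this seat's FILE 70c `…KingModelSrcDivMismatch` (TERM A ∕ TERM B, `idef_finsum`, `blockAvg_finsum`) and FILE 69
`…KingModelSrcDivByParts` (`bLetter_sub_coarseStepQuot`, `bbar_eq_blockAvg_coarseStepQuot`, `blockAvg_shift_pow`, `abs_shiftFit_le`, `abs_bLetter_le`, `abs_wLetter_le`),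
`T4EtaRateDefect.idef_comp ∕ idef_add`, `T4EtaRateCoeffDefect.hasMaj_mulOp`, `Gluing.hasMaj_comp_diag`, `DerivDefect.hasMaj_finset_sum` BY NAME; nothing in the tree is modified.

WHY (this seat's ARCHITECTURE NOTE «ENTRY 2 LIVE BY PARTS», pub-ymgap INBOX l.43300).  `T4EtaRateDefect.idef_neumann_majorant_flat` wants, besides the source defect, (hK′) a
row of the fine step, (hDK) a row of the step defect `𝔇(𝕄′, 𝕄̄₁)` — here at the FITTED coarse letters, where each summand is `front ∘ 𝔇(M_{g′}, M_{blockAvg g′})` (a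
divergence-form cell-oscillation row: dag-n15-a K-A for `G′`, this seat's FILE 67 ∕ 70a for `G′N′∇′_μ`) `+ 𝔇(front)∘M_{blockAvg g′}` (an η-rate row) — and (hDS) the
source defect, whose coarse partner `Ȳ − 𝕄̄₁Ȳ = S̄_κ + (𝕄̄ − 𝕄̄₁)Ȳ` carries the transported mismatch row of §1.

WHAT.  §1 ★★ `hasMaj_pull_stepMismatch`: `P∘(𝕄̄ − 𝕄̄₁)∘Ȳ ≤ (d+1)·βc_r·rA·((2e^{δ}+3)L^{−K} + 2θ)·e^{−(δ∕2)d}` (`𝕄̄ − 𝕄̄₁ = Σ_μ [ḠM_{blockAvg(b′_μ−B′_μ)} +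
(ḠN̄∇̄_μ)M_{ã̄_μ − blockAvg ã′_μ}]` by FILE 69's letter identities).  §2 ★ `hasMaj_fineStep`: `𝕄′ ≤ βr(2d+3)e^{−δd}`.  §3 ★★ `hasMaj_idef_step`:
`𝔇(𝕄′, 𝕄̄₁) ≤ βr·((d+2)(L^{−K} + θ) + (d+1)(x + θ))·e^{−δd}` (`x` = the cell-oscillation rate of the forward fronts, `(L^K)^{−1∕(8(d+1))}` on the King rung).

HONEST FRAMING ∕ LIMITS.  Count-neutral operator bookkeeping on King's two-grid 1-form carrier (template literature [King1986] (2.13)–(2.17) p.653; [Balaban1985BackgroundPropagators]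
(3.52) p.400, (3.62)–(3.65) pp.402–403: SHAPES ∕ mechanism) — abstract fronts, rows as hypotheses (discharged on the King rung in FILE 70e); NOT Bałaban's covariant `G(U)`.  NE2⁺ NOT
PRINTED ∕ NOT proved; no statement of record touched; N15 NOT discharged; K3⁸ OPEN; counts UNMOVED (typed 28∕28 · discharged 5∕27); one finite torus per index — NOT ℝ⁴ ∕ infinite
volume ∕ OS ∕ mass gap ∕ Clay.
-/

noncomputable section

open scoped BigOperators Matrix
open Finset

namespace Summit.QuantumFields.YangMills.BalabanUVNodes.N15.KingModel.SrcDiv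

open Literature.MathematicalPhysics.QuantumFieldTheory.Balaban1983to89
open Literature.MathematicalPhysics.QuantumFieldTheory.Balaban1983to89.B11SectG (BlockNorm HasMaj)
open Literature.MathematicalPhysics.QuantumFieldTheory.Balaban1983to89.T4EtaRateDefect (idef idef_apply idef_comp idef_add)
open Literature.MathematicalPhysics.QuantumFieldTheory.Balaban1983to89.T4EtaRateCoeffDefect (pull pull_apply blockAvg diagK hasMaj_mulOp)
open Literature.MathematicalPhysics.QuantumFieldTheory.Balaban1983to89.B6Prop26Gluing (mulOp mulOp_apply)
open Literature.MathematicalPhysics.QuantumFieldTheory.Balaban1983to89.B5Prop11Plancherel (Tor fine unitVec)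
open Literature.MathematicalPhysics.QuantumFieldTheory.King1986.Torus (blockOf tdistT tdistT_nonneg)
open Literature.MathematicalPhysics.QuantumFieldTheory.Balaban1983to89.B6UnitTorusCarrier (unitTorusGeo)
open Summit.QuantumFields.YangMills.BalabanUVNodes.N15.VectorPiece (kingPrV blkFine bshiftEquiv)
open Summit.QuantumFields.YangMills.BalabanUVNodes.N15.BackgroundLayer (fgrad abs_blockAvg_le blockAvg_sub)
open Summit.QuantumFields.YangMills.BalabanUVNodes.N15.TwoGrid (symbOp sD sTinv)
open Summit.QuantumFields.YangMills.BalabanUVNodes.N15.Gluing (hasMaj_comp_diag)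
open Summit.QuantumFields.YangMills.BalabanUVNodes.N15.DerivDefect (hasMaj_finset_sum)
open Summit.QuantumFields.YangMills.BalabanUVNodes.N15.BackgroundModel (kappa_ofBlocks)

variable {d : ℕ} (L : ℕ) [NeZero L] (M : Fin (d + 1) → ℕ) [∀ μ, NeZero (M μ)] (K n : ℕ)

/-! ## §1 The transported letter mismatch at King's two-grid letters -/

set_option maxHeartbeats 400000 in
/-- ★★ **THE TRANSPORTED LETTER MISMATCH.**  Behind abstract fronts `G′` (fine: plain, divergence-form, divergence-form cell-oscillation rows), `Ḡ` (coarse: η-defect row against `G′`,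
forward rows `ḠN̄∇̄_μ`) and a coarse `Ȳ` (rows of `Ȳ`, `N̄∇̄_μȲ`), for fine letters `a′_μ` with `|N′∇′_κ a′_μ| ≤ r`: the TRUE coarse by-parts step `𝕄̄` (letters
`w̄ = c̄ − Σ_μ N̄(ā_μ − ā_μ(·−ē_μ))`, `ã̄_μ = ā_μ(·−ē_μ)`, `c̄, ā` the block averages) minus the FITTED one `𝕄̄₁` (block averages of `w′ = c′ − Σ_μ b′_μ`, `ã′_μ = a′_μ(·−e′_μ)`),
transported and dressed: `P∘(𝕄̄ − 𝕄̄₁)∘Ȳ ≤ (d+1)·βc_r·rA·((2e^{δ}+3)L^{−K} + 2θ)·e^{−(δ∕2)|y−y′|_T}`. [cite: Balaban1985BackgroundPropagators, (3.35) p.396 (letters), (3.62)–(3.65)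
pp.402–403 (mechanism); King1986, (2.16) p.653, Prop. 3.9 (3.73) p.665 (rate factor)] -/
theorem hasMaj_pull_stepMismatch
    {G' : Module.End ℝ (Tor (fine (L ^ n * L ^ K) M) × Fin (d + 1) → ℝ)} {Gc Y : Module.End ℝ (Tor (fine (L ^ K) M) × Fin (d + 1) → ℝ)}
    {β A θ δ r : ℝ} (hβ : 0 ≤ β) (hA : 0 ≤ A) (hθ : 0 ≤ θ) (hδ : 0 < δ) (hr : 0 ≤ r) (hM2 : ∀ μ, 2 ≤ fine (L ^ K) M μ)
    (hG' : HasMaj (BlockNorm.ofBlocks (unitTorusGeo L K M) (fun i : Tor (fine (L ^ n * L ^ K) M) × Fin (d + 1) => blockOf (L ^ n * L ^ K) M i.1))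
      (BlockNorm.ofBlocks (unitTorusGeo L K M) (fun i : Tor (fine (L ^ n * L ^ K) M) × Fin (d + 1) => blockOf (L ^ n * L ^ K) M i.1)) G'
      (fun y y' => β * Real.exp (-(δ * tdistT M y y'))))
    (hS' : ∀ μ, HasMaj (BlockNorm.ofBlocks (unitTorusGeo L K M) (fun i : Tor (fine (L ^ n * L ^ K) M) × Fin (d + 1) => blockOf (L ^ n * L ^ K) M i.1))
      (BlockNorm.ofBlocks (unitTorusGeo L K M) (fun i : Tor (fine (L ^ n * L ^ K) M) × Fin (d + 1) => blockOf (L ^ n * L ^ K) M i.1))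
      (G' ∘ₗ symbOp M (L ^ n * L ^ K) (((L ^ n * L ^ K : ℕ) : ℝ) • (sTinv M (L ^ n * L ^ K) μ - 1))) (fun y y' => β * Real.exp (-(δ * tdistT M y y'))))
    (hY : HasMaj (BlockNorm.ofBlocks (unitTorusGeo L K M) (blkFine L K M)) (BlockNorm.ofBlocks (unitTorusGeo L K M) (blkFine L K M)) Y
      (fun y y' => A * Real.exp (-(δ * tdistT M y y'))))
    (hDY : ∀ μ, HasMaj (BlockNorm.ofBlocks (unitTorusGeo L K M) (blkFine L K M)) (BlockNorm.ofBlocks (unitTorusGeo L K M) (blkFine L K M))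
      (symbOp M (L ^ K) (sD M (L ^ K) μ ((L ^ K : ℕ) : ℝ)) ∘ₗ Y) (fun y y' => A * Real.exp (-(δ * tdistT M y y'))))
    (hDG : HasMaj (BlockNorm.ofBlocks (unitTorusGeo L K M) (blkFine L K M))
      (BlockNorm.ofBlocks (unitTorusGeo L K M) (fun i : Tor (fine (L ^ n * L ^ K) M) × Fin (d + 1) => blockOf (L ^ n * L ^ K) M i.1))
      (idef (pull (kingPrV L K n M)) (pull (kingPrV L K n M)) G' Gc) (fun y y' => β * θ * Real.exp (-(δ * tdistT M y y'))))
    (hGc : ∀ (g : Tor (fine (L ^ n * L ^ K) M) × Fin (d + 1) → ℝ) (s : ℝ), 0 ≤ s → (∀ p, |g p| ≤ s) →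
      HasMaj (BlockNorm.ofBlocks (unitTorusGeo L K M) (blkFine L K M))
        (BlockNorm.ofBlocks (unitTorusGeo L K M) (fun i : Tor (fine (L ^ n * L ^ K) M) × Fin (d + 1) => blockOf (L ^ n * L ^ K) M i.1))
        (G' ∘ₗ idef (pull (kingPrV L K n M)) (pull (kingPrV L K n M)) (mulOp g) (mulOp (blockAvg (kingPrV L K n M) g)))
        (fun y y' => β * s * (((L ^ K : ℕ) : ℝ))⁻¹ * Real.exp (-(δ * tdistT M y y'))))
    (hSc : ∀ μ, HasMaj (BlockNorm.ofBlocks (unitTorusGeo L K M) (blkFine L K M)) (BlockNorm.ofBlocks (unitTorusGeo L K M) (blkFine L K M))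
      (Gc ∘ₗ symbOp M (L ^ K) (sD M (L ^ K) μ ((L ^ K : ℕ) : ℝ))) (fun y y' => β * Real.exp (-(δ * tdistT M y y'))))
    {c' : Tor (fine (L ^ n * L ^ K) M) × Fin (d + 1) → ℝ} {a' : Fin (d + 1) → Tor (fine (L ^ n * L ^ K) M) × Fin (d + 1) → ℝ}
    (hfa' : ∀ μ κ z, |fgrad ((L ^ n * L ^ K : ℕ) : ℝ) (bshiftEquiv M (L ^ n * L ^ K) κ) (a' μ) z| ≤ r) :
    HasMaj (BlockNorm.ofBlocks (unitTorusGeo L K M) (blkFine L K M))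
      (BlockNorm.ofBlocks (unitTorusGeo L K M) (fun i : Tor (fine (L ^ n * L ^ K) M) × Fin (d + 1) => blockOf (L ^ n * L ^ K) M i.1))
      (pull (kingPrV L K n M) ∘ₗ
        ((Gc ∘ₗ mulOp (fun q : Tor (fine (L ^ K) M) × Fin (d + 1) => blockAvg (kingPrV L K n M) c' q
              - ∑ μ, ((L ^ K : ℕ) : ℝ) * (blockAvg (kingPrV L K n M) (a' μ) q - blockAvg (kingPrV L K n M) (a' μ) (q.1 - unitVec (fine (L ^ K) M) μ, q.2)))
            + ∑ μ, (Gc ∘ₗ symbOp M (L ^ K) (sD M (L ^ K) μ ((L ^ K : ℕ) : ℝ))) ∘ₗ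
                mulOp (fun q : Tor (fine (L ^ K) M) × Fin (d + 1) => blockAvg (kingPrV L K n M) (a' μ) (q.1 - unitVec (fine (L ^ K) M) μ, q.2)))
          - (Gc ∘ₗ mulOp (blockAvg (kingPrV L K n M) (fun p : Tor (fine (L ^ n * L ^ K) M) × Fin (d + 1) =>
                c' p - ∑ μ, ((L ^ n * L ^ K : ℕ) : ℝ) * (a' μ p - a' μ (p.1 - unitVec (fine (L ^ n * L ^ K) M) μ, p.2))))
              + ∑ μ, (Gc ∘ₗ symbOp M (L ^ K) (sD M (L ^ K) μ ((L ^ K : ℕ) : ℝ))) ∘ₗ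
                  mulOp (blockAvg (kingPrV L K n M) (fun p : Tor (fine (L ^ n * L ^ K) M) × Fin (d + 1) => a' μ (p.1 - unitVec (fine (L ^ n * L ^ K) M) μ, p.2))))) ∘ₗ
        Y)
      (fun y y' => ((d : ℝ) + 1) * (β * B4Sect5Proof.latticeConst (d + 1) (δ / 2) * r * A * ((2 * Real.exp δ + 3) * (((L ^ K : ℕ) : ℝ))⁻¹ + 2 * θ)) *
        Real.exp (-(δ / 2 * tdistT M y y'))) := by
  have hL0 : 0 < L := Nat.pos_of_ne_zero (NeZero.ne L)
  have hℓr : (0 : ℝ) < ((L ^ n : ℕ) : ℝ) := by positivity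
  have hLKr : (0 : ℝ) < ((L ^ K : ℕ) : ℝ) := by positivity
  have hω : (0 : ℝ) ≤ r / ((L ^ K : ℕ) : ℝ) := by positivity
  -- the fine letters `b′_μ`, the mismatch `χ_μ = b′_μ − B′_μ` (an average of shift commutators) and the coarse mismatch `g_μ = ã̄_μ − blockAvg ã′_μ`
  have hf : ∀ (μ : Fin (d + 1)) (p : Tor (fine (L ^ n * L ^ K) M) × Fin (d + 1)),
      |((L ^ n * L ^ K : ℕ) : ℝ) * (a' μ p - a' μ (p.1 - unitVec (fine (L ^ n * L ^ K) M) μ, p.2))| ≤ r :=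
    fun μ p => abs_bLetter_le (N := L ^ n * L ^ K) (M := M) μ (hfa' μ μ) p
  have hχ : ∀ (μ : Fin (d + 1)) (p : Tor (fine (L ^ n * L ^ K) M) × Fin (d + 1)),
      ((L ^ n * L ^ K : ℕ) : ℝ) * (a' μ p - a' μ (p.1 - unitVec (fine (L ^ n * L ^ K) M) μ, p.2))
          - ((L ^ K : ℕ) : ℝ) * (a' μ p - a' μ (p.1 - L ^ n • unitVec (fine (L ^ n * L ^ K) M) μ, p.2))
        = (((L ^ n : ℕ) : ℝ))⁻¹ * ∑ j ∈ range (L ^ n),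
            (((L ^ n * L ^ K : ℕ) : ℝ) * (a' μ p - a' μ (p.1 - unitVec (fine (L ^ n * L ^ K) M) μ, p.2))
              - ((L ^ n * L ^ K : ℕ) : ℝ) * (a' μ (p.1 - j • unitVec (fine (L ^ n * L ^ K) M) μ, p.2)
                  - a' μ (p.1 - j • unitVec (fine (L ^ n * L ^ K) M) μ - unitVec (fine (L ^ n * L ^ K) M) μ, p.2))) :=
    fun μ p => bLetter_sub_coarseStepQuot L M K n hL0 (a' μ) μ p
  have hg : ∀ (μ : Fin (d + 1)) (q : Tor (fine (L ^ K) M) × Fin (d + 1)),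
      |blockAvg (kingPrV L K n M) (a' μ) (q.1 - unitVec (fine (L ^ K) M) μ, q.2)
          - blockAvg (kingPrV L K n M) (fun p : Tor (fine (L ^ n * L ^ K) M) × Fin (d + 1) => a' μ (p.1 - unitVec (fine (L ^ n * L ^ K) M) μ, p.2)) q|
        ≤ r / ((L ^ K : ℕ) : ℝ) := fun μ q => by
    rw [blockAvg_shift_pow L M K n (a' μ) μ q, ← blockAvg_sub]
    exact abs_blockAvg_le (kingPrV L K n M) hω (fun p => abs_shiftFit_le L M K n hL0 hr μ (hfa' μ μ) p) q
  -- TERM B and TERM A per direction (FILE 70c)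
  have hB := fun μ : Fin (d + 1) =>
    hasMaj_pull_front_mulOp_blockAvg L M K n hβ hA hθ hδ hr hM2 hG' hS' hY hDY hDG hGc μ (hf μ) (hχ μ)
  have hT := fun μ : Fin (d + 1) => hasMaj_pull_frontFwd_mulOp L M K n hβ hA hδ hω μ (hSc μ) hY (hg μ)
  have hsum := hasMaj_finset_sum (g := unitTorusGeo L K M) (Finset.univ : Finset (Fin (d + 1))) fun μ _ => (hB μ).add (hT μ)
  refine (hsum.congr fun v => ?_).mono fun y y' => ?_
  · -- the letter identities (FILE 69): `w̄ − blockAvg w′ = Σ_μ blockAvg χ_μ`, `ã̄_μ − blockAvg ã′_μ = g_μ`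
    have hv1 : ∀ w : Tor (fine (L ^ K) M) × Fin (d + 1) → ℝ,
        mulOp (fun q : Tor (fine (L ^ K) M) × Fin (d + 1) => blockAvg (kingPrV L K n M) c' q
            - ∑ μ, ((L ^ K : ℕ) : ℝ) * (blockAvg (kingPrV L K n M) (a' μ) q - blockAvg (kingPrV L K n M) (a' μ) (q.1 - unitVec (fine (L ^ K) M) μ, q.2))) w
          - mulOp (blockAvg (kingPrV L K n M) (fun p : Tor (fine (L ^ n * L ^ K) M) × Fin (d + 1) =>
              c' p - ∑ μ, ((L ^ n * L ^ K : ℕ) : ℝ) * (a' μ p - a' μ (p.1 - unitVec (fine (L ^ n * L ^ K) M) μ, p.2)))) w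
        = ∑ μ, mulOp (blockAvg (kingPrV L K n M) (fun p : Tor (fine (L ^ n * L ^ K) M) × Fin (d + 1) =>
            ((L ^ n * L ^ K : ℕ) : ℝ) * (a' μ p - a' μ (p.1 - unitVec (fine (L ^ n * L ^ K) M) μ, p.2))
              - ((L ^ K : ℕ) : ℝ) * (a' μ p - a' μ (p.1 - L ^ n • unitVec (fine (L ^ n * L ^ K) M) μ, p.2)))) w := fun w => by
      refine funext fun q => ?_
      simp only [mulOp_apply, Pi.sub_apply, Finset.sum_apply]
      rw [← sub_mul, ← Finset.sum_mul]
      congr 1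
      have ew : blockAvg (kingPrV L K n M) (fun p : Tor (fine (L ^ n * L ^ K) M) × Fin (d + 1) =>
            c' p - ∑ μ, ((L ^ n * L ^ K : ℕ) : ℝ) * (a' μ p - a' μ (p.1 - unitVec (fine (L ^ n * L ^ K) M) μ, p.2))) q
          = blockAvg (kingPrV L K n M) c' q - ∑ μ, blockAvg (kingPrV L K n M) (fun p : Tor (fine (L ^ n * L ^ K) M) × Fin (d + 1) =>
              ((L ^ n * L ^ K : ℕ) : ℝ) * (a' μ p - a' μ (p.1 - unitVec (fine (L ^ n * L ^ K) M) μ, p.2))) q := by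
        rw [← blockAvg_finsum, ← blockAvg_sub]
      rw [ew]
      simp only [bbar_eq_blockAvg_coarseStepQuot L M K n, blockAvg_sub, Finset.sum_sub_distrib]
      ring
    have hv2 : ∀ (μ : Fin (d + 1)) (w : Tor (fine (L ^ K) M) × Fin (d + 1) → ℝ),
        mulOp (fun q : Tor (fine (L ^ K) M) × Fin (d + 1) => blockAvg (kingPrV L K n M) (a' μ) (q.1 - unitVec (fine (L ^ K) M) μ, q.2)) w
          - mulOp (blockAvg (kingPrV L K n M) (fun p : Tor (fine (L ^ n * L ^ K) M) × Fin (d + 1) => a' μ (p.1 - unitVec (fine (L ^ n * L ^ K) M) μ, p.2))) w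
        = mulOp (fun q : Tor (fine (L ^ K) M) × Fin (d + 1) => blockAvg (kingPrV L K n M) (a' μ) (q.1 - unitVec (fine (L ^ K) M) μ, q.2)
            - blockAvg (kingPrV L K n M) (fun p : Tor (fine (L ^ n * L ^ K) M) × Fin (d + 1) => a' μ (p.1 - unitVec (fine (L ^ n * L ^ K) M) μ, p.2)) q) w :=
      fun μ w => funext fun q => by simp only [mulOp_apply, Pi.sub_apply]; ring
    simp only [LinearMap.sum_apply, LinearMap.comp_apply, LinearMap.add_apply, LinearMap.sub_apply]
    rw [eq_add_of_sub_eq (hv1 (Y v))]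
    simp only [fun μ => eq_add_of_sub_eq (hv2 μ (Y v)), map_add, map_sub, map_sum, Finset.sum_add_distrib]
    abel
  · rw [Finset.sum_const, Finset.card_univ, Fintype.card_fin, nsmul_eq_mul]
    push_cast
    apply le_of_eq
    field_simp
    ring

/-! ## §2 The fine by-parts step -/

/-- ★ **THE FINE BY-PARTS STEP HAS A SMALL ROW**: behind the fine front (`G′, G′N′∇′_μ ≤ βe^{−δd}`) and under the three (3.35) letters `|c′|, |a′_μ|, |N′∇′_κa′_μ| ≤ r`,
`𝕄′ = G′M_{w′} + Σ_μ (G′N′∇′_μ)M_{ã′_μ} ≤ βr(2d+3)·e^{−δd}` (`|w′| ≤ (d+2)r` by FILE 69 `abs_wLetter_le`, `|ã′_μ| ≤ r`). [cite: Balaban1985BackgroundPropagators, (3.35) p.396,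
(3.65) p.403] -/
theorem hasMaj_fineStep {G' : Module.End ℝ (Tor (fine (L ^ n * L ^ K) M) × Fin (d + 1) → ℝ)} {β δ r : ℝ} (hβ : 0 ≤ β) (hr : 0 ≤ r)
    (hG' : HasMaj (BlockNorm.ofBlocks (unitTorusGeo L K M) (fun i : Tor (fine (L ^ n * L ^ K) M) × Fin (d + 1) => blockOf (L ^ n * L ^ K) M i.1))
      (BlockNorm.ofBlocks (unitTorusGeo L K M) (fun i : Tor (fine (L ^ n * L ^ K) M) × Fin (d + 1) => blockOf (L ^ n * L ^ K) M i.1)) G'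
      (fun y y' => β * Real.exp (-(δ * tdistT M y y'))))
    (hSf : ∀ μ, HasMaj (BlockNorm.ofBlocks (unitTorusGeo L K M) (fun i : Tor (fine (L ^ n * L ^ K) M) × Fin (d + 1) => blockOf (L ^ n * L ^ K) M i.1))
      (BlockNorm.ofBlocks (unitTorusGeo L K M) (fun i : Tor (fine (L ^ n * L ^ K) M) × Fin (d + 1) => blockOf (L ^ n * L ^ K) M i.1))
      (G' ∘ₗ symbOp M (L ^ n * L ^ K) (sD M (L ^ n * L ^ K) μ ((L ^ n * L ^ K : ℕ) : ℝ))) (fun y y' => β * Real.exp (-(δ * tdistT M y y'))))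
    {c' : Tor (fine (L ^ n * L ^ K) M) × Fin (d + 1) → ℝ} {a' : Fin (d + 1) → Tor (fine (L ^ n * L ^ K) M) × Fin (d + 1) → ℝ}
    (hc' : ∀ z, |c' z| ≤ r) (ha' : ∀ μ z, |a' μ z| ≤ r) (hfa' : ∀ μ κ z, |fgrad ((L ^ n * L ^ K : ℕ) : ℝ) (bshiftEquiv M (L ^ n * L ^ K) κ) (a' μ) z| ≤ r) :
    HasMaj (BlockNorm.ofBlocks (unitTorusGeo L K M) (fun i : Tor (fine (L ^ n * L ^ K) M) × Fin (d + 1) => blockOf (L ^ n * L ^ K) M i.1))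
      (BlockNorm.ofBlocks (unitTorusGeo L K M) (fun i : Tor (fine (L ^ n * L ^ K) M) × Fin (d + 1) => blockOf (L ^ n * L ^ K) M i.1))
      (G' ∘ₗ mulOp (fun p : Tor (fine (L ^ n * L ^ K) M) × Fin (d + 1) =>
            c' p - ∑ μ, ((L ^ n * L ^ K : ℕ) : ℝ) * (a' μ p - a' μ (p.1 - unitVec (fine (L ^ n * L ^ K) M) μ, p.2)))
        + ∑ μ, (G' ∘ₗ symbOp M (L ^ n * L ^ K) (sD M (L ^ n * L ^ K) μ ((L ^ n * L ^ K : ℕ) : ℝ))) ∘ₗ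
            mulOp (fun p : Tor (fine (L ^ n * L ^ K) M) × Fin (d + 1) => a' μ (p.1 - unitVec (fine (L ^ n * L ^ K) M) μ, p.2)))
      (fun y y' => β * r * (2 * (d : ℝ) + 3) * Real.exp (-(δ * tdistT M y y'))) := by
  have hdr : (0 : ℝ) ≤ ((d : ℝ) + 2) * r := by positivity
  have hw := hasMaj_mulOp (g := unitTorusGeo L K M) (fun i : Tor (fine (L ^ n * L ^ K) M) × Fin (d + 1) => blockOf (L ^ n * L ^ K) M i.1)
    (m := fun _ => ((d : ℝ) + 2) * r) (fun _ => hdr) (abs_wLetter_le (N := L ^ n * L ^ K) (M := M) hc' hfa')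
  have h0 := hasMaj_comp_diag (g := unitTorusGeo L K M) (fun i : Tor (fine (L ^ n * L ^ K) M) × Fin (d + 1) => blockOf (L ^ n * L ^ K) M i.1)
    (fun y y' => by positivity) hG' hw
  have ha : ∀ μ, HasMaj (BlockNorm.ofBlocks (unitTorusGeo L K M) (fun i : Tor (fine (L ^ n * L ^ K) M) × Fin (d + 1) => blockOf (L ^ n * L ^ K) M i.1))
      (BlockNorm.ofBlocks (unitTorusGeo L K M) (fun i : Tor (fine (L ^ n * L ^ K) M) × Fin (d + 1) => blockOf (L ^ n * L ^ K) M i.1))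
      (mulOp (fun p : Tor (fine (L ^ n * L ^ K) M) × Fin (d + 1) => a' μ (p.1 - unitVec (fine (L ^ n * L ^ K) M) μ, p.2))) (diagK fun _ => r) := fun μ =>
    hasMaj_mulOp (g := unitTorusGeo L K M) (fun i : Tor (fine (L ^ n * L ^ K) M) × Fin (d + 1) => blockOf (L ^ n * L ^ K) M i.1)
      (m := fun _ => r) (fun _ => hr) (fun p => ha' μ _)
  have h1 := hasMaj_finset_sum (g := unitTorusGeo L K M) (Finset.univ : Finset (Fin (d + 1))) fun μ _ =>
    hasMaj_comp_diag (g := unitTorusGeo L K M) (fun i : Tor (fine (L ^ n * L ^ K) M) × Fin (d + 1) => blockOf (L ^ n * L ^ K) M i.1)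
      (fun y y' => by positivity) (hSf μ) (ha μ)
  refine (h0.add h1).mono fun y y' => ?_
  rw [Finset.sum_const, Finset.card_univ, Fintype.card_fin, nsmul_eq_mul]
  push_cast
  apply le_of_eq
  ring

/-! ## §3 The step defect against the FITTED coarse step -/

set_option maxHeartbeats 400000 in
/-- ★★ **THE STEP DEFECT AT THE FITTED LETTERS.**  Behind the fronts' η-defect rows (`𝔇(G′,Ḡ), 𝔇(G′N′∇′_μ, ḠN̄∇̄_μ) ≤ βθe^{−δd}`) and their divergence-form cell-oscillation rows
(`G′∘𝔇(M_g, M_{ḡ}) ≤ βs·L^{−K}e^{−δd}`, `(G′N′∇′_μ)∘𝔇(M_g, M_{ḡ}) ≤ βs·x·e^{−δd}` for `|g| ≤ s`, `ḡ` the block average), under the three (3.35) letters: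
`𝔇(𝕄′, 𝕄̄₁) ≤ βr·((d+2)(L^{−K} + θ) + (d+1)(x + θ))·e^{−δd}`, `𝕄̄₁ = ḠM_{blockAvg w′} + Σ_μ (ḠN̄∇̄_μ)M_{blockAvg ã′_μ}` — Leibniz (`idef_comp`) termwise.
[cite: Balaban1985BackgroundPropagators, (3.35) p.396, (3.62)–(3.65) pp.402–403 (mechanism); King1986, Prop. 3.9 (3.73) p.665 (rate factor)] -/
theorem hasMaj_idef_step
    {G' : Module.End ℝ (Tor (fine (L ^ n * L ^ K) M) × Fin (d + 1) → ℝ)} {Gc : Module.End ℝ (Tor (fine (L ^ K) M) × Fin (d + 1) → ℝ)}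
    {β θ x δ r : ℝ} (hβ : 0 ≤ β) (hθ : 0 ≤ θ) (hr : 0 ≤ r)
    (hDG : HasMaj (BlockNorm.ofBlocks (unitTorusGeo L K M) (blkFine L K M))
      (BlockNorm.ofBlocks (unitTorusGeo L K M) (fun i : Tor (fine (L ^ n * L ^ K) M) × Fin (d + 1) => blockOf (L ^ n * L ^ K) M i.1))
      (idef (pull (kingPrV L K n M)) (pull (kingPrV L K n M)) G' Gc) (fun y y' => β * θ * Real.exp (-(δ * tdistT M y y'))))
    (hGc : ∀ (g : Tor (fine (L ^ n * L ^ K) M) × Fin (d + 1) → ℝ) (s : ℝ), 0 ≤ s → (∀ p, |g p| ≤ s) →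
      HasMaj (BlockNorm.ofBlocks (unitTorusGeo L K M) (blkFine L K M))
        (BlockNorm.ofBlocks (unitTorusGeo L K M) (fun i : Tor (fine (L ^ n * L ^ K) M) × Fin (d + 1) => blockOf (L ^ n * L ^ K) M i.1))
        (G' ∘ₗ idef (pull (kingPrV L K n M)) (pull (kingPrV L K n M)) (mulOp g) (mulOp (blockAvg (kingPrV L K n M) g)))
        (fun y y' => β * s * (((L ^ K : ℕ) : ℝ))⁻¹ * Real.exp (-(δ * tdistT M y y'))))
    (hDSf : ∀ μ, HasMaj (BlockNorm.ofBlocks (unitTorusGeo L K M) (blkFine L K M))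
      (BlockNorm.ofBlocks (unitTorusGeo L K M) (fun i : Tor (fine (L ^ n * L ^ K) M) × Fin (d + 1) => blockOf (L ^ n * L ^ K) M i.1))
      (idef (pull (kingPrV L K n M)) (pull (kingPrV L K n M)) (G' ∘ₗ symbOp M (L ^ n * L ^ K) (sD M (L ^ n * L ^ K) μ ((L ^ n * L ^ K : ℕ) : ℝ)))
        (Gc ∘ₗ symbOp M (L ^ K) (sD M (L ^ K) μ ((L ^ K : ℕ) : ℝ))))
      (fun y y' => β * θ * Real.exp (-(δ * tdistT M y y'))))
    (hSfc : ∀ (μ : Fin (d + 1)) (g : Tor (fine (L ^ n * L ^ K) M) × Fin (d + 1) → ℝ) (s : ℝ), 0 ≤ s → (∀ p, |g p| ≤ s) →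
      HasMaj (BlockNorm.ofBlocks (unitTorusGeo L K M) (blkFine L K M))
        (BlockNorm.ofBlocks (unitTorusGeo L K M) (fun i : Tor (fine (L ^ n * L ^ K) M) × Fin (d + 1) => blockOf (L ^ n * L ^ K) M i.1))
        ((G' ∘ₗ symbOp M (L ^ n * L ^ K) (sD M (L ^ n * L ^ K) μ ((L ^ n * L ^ K : ℕ) : ℝ))) ∘ₗ
          idef (pull (kingPrV L K n M)) (pull (kingPrV L K n M)) (mulOp g) (mulOp (blockAvg (kingPrV L K n M) g)))
        (fun y y' => β * s * x * Real.exp (-(δ * tdistT M y y'))))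
    {c' : Tor (fine (L ^ n * L ^ K) M) × Fin (d + 1) → ℝ} {a' : Fin (d + 1) → Tor (fine (L ^ n * L ^ K) M) × Fin (d + 1) → ℝ}
    (hc' : ∀ z, |c' z| ≤ r) (ha' : ∀ μ z, |a' μ z| ≤ r) (hfa' : ∀ μ κ z, |fgrad ((L ^ n * L ^ K : ℕ) : ℝ) (bshiftEquiv M (L ^ n * L ^ K) κ) (a' μ) z| ≤ r) :
    HasMaj (BlockNorm.ofBlocks (unitTorusGeo L K M) (blkFine L K M))
      (BlockNorm.ofBlocks (unitTorusGeo L K M) (fun i : Tor (fine (L ^ n * L ^ K) M) × Fin (d + 1) => blockOf (L ^ n * L ^ K) M i.1))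
      (idef (pull (kingPrV L K n M)) (pull (kingPrV L K n M))
        (G' ∘ₗ mulOp (fun p : Tor (fine (L ^ n * L ^ K) M) × Fin (d + 1) =>
              c' p - ∑ μ, ((L ^ n * L ^ K : ℕ) : ℝ) * (a' μ p - a' μ (p.1 - unitVec (fine (L ^ n * L ^ K) M) μ, p.2)))
          + ∑ μ, (G' ∘ₗ symbOp M (L ^ n * L ^ K) (sD M (L ^ n * L ^ K) μ ((L ^ n * L ^ K : ℕ) : ℝ))) ∘ₗ
              mulOp (fun p : Tor (fine (L ^ n * L ^ K) M) × Fin (d + 1) => a' μ (p.1 - unitVec (fine (L ^ n * L ^ K) M) μ, p.2)))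
        (Gc ∘ₗ mulOp (blockAvg (kingPrV L K n M) (fun p : Tor (fine (L ^ n * L ^ K) M) × Fin (d + 1) =>
              c' p - ∑ μ, ((L ^ n * L ^ K : ℕ) : ℝ) * (a' μ p - a' μ (p.1 - unitVec (fine (L ^ n * L ^ K) M) μ, p.2))))
          + ∑ μ, (Gc ∘ₗ symbOp M (L ^ K) (sD M (L ^ K) μ ((L ^ K : ℕ) : ℝ))) ∘ₗ
              mulOp (blockAvg (kingPrV L K n M) (fun p : Tor (fine (L ^ n * L ^ K) M) × Fin (d + 1) => a' μ (p.1 - unitVec (fine (L ^ n * L ^ K) M) μ, p.2)))))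
      (fun y y' => β * r * (((d : ℝ) + 2) * ((((L ^ K : ℕ) : ℝ))⁻¹ + θ) + ((d : ℝ) + 1) * (x + θ)) * Real.exp (-(δ * tdistT M y y'))) := by
  have hdr : (0 : ℝ) ≤ ((d : ℝ) + 2) * r := by positivity
  have hw' := abs_wLetter_le (N := L ^ n * L ^ K) (M := M) hc' hfa'
  -- the `w`-summand: `G′∘𝔇(M_{w′}, M_{w̄′}) + 𝔇(G′,Ḡ)∘M_{w̄′}`
  have hw1 := hGc _ (((d : ℝ) + 2) * r) hdr hw'
  have hw2 := hasMaj_comp_diag (g := unitTorusGeo L K M) (blkFine L K M) (fun y y' => by positivity) hDG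
    (hasMaj_mulOp (g := unitTorusGeo L K M) (blkFine L K M) (m := fun _ => ((d : ℝ) + 2) * r) (fun _ => hdr) (abs_blockAvg_le (kingPrV L K n M) hdr hw'))
  -- the `ã_μ`-summands
  have ha1 := fun μ : Fin (d + 1) => hSfc μ (fun p : Tor (fine (L ^ n * L ^ K) M) × Fin (d + 1) => a' μ (p.1 - unitVec (fine (L ^ n * L ^ K) M) μ, p.2)) r hr
    (fun p => ha' μ _)
  have ha2 := fun μ : Fin (d + 1) => hasMaj_comp_diag (g := unitTorusGeo L K M) (blkFine L K M) (fun y y' => by positivity) (hDSf μ)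
    (hasMaj_mulOp (g := unitTorusGeo L K M) (blkFine L K M) (m := fun _ => r) (fun _ => hr)
      (abs_blockAvg_le (kingPrV L K n M) hr (fun p => ha' μ _) :
        ∀ q, |blockAvg (kingPrV L K n M) (fun p : Tor (fine (L ^ n * L ^ K) M) × Fin (d + 1) => a' μ (p.1 - unitVec (fine (L ^ n * L ^ K) M) μ, p.2)) q| ≤ r))
  have hsum := hasMaj_finset_sum (g := unitTorusGeo L K M) (Finset.univ : Finset (Fin (d + 1))) fun μ _ => (ha1 μ).add (ha2 μ)
  refine (((hw1.add hw2).add hsum).congr fun v => ?_).mono fun y y' => ?_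
  · rw [idef_add, idef_finsum]
    simp only [LinearMap.add_apply, LinearMap.sum_apply]
    congr 1
    · simp only [LinearMap.comp_apply, idef_apply, map_sub]
      abel
    · refine Finset.sum_congr rfl fun μ _ => ?_
      simp only [LinearMap.comp_apply, idef_apply, map_sub]
      abel
  rw [Finset.sum_const, Finset.card_univ, Fintype.card_fin, nsmul_eq_mul]
  push_cast
  apply le_of_eq
  ring

end Summit.QuantumFields.YangMills.BalabanUVNodes.N15.KingModel.SrcDiv

end
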